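import Summits.HodgeConjecture.HodgeConjecture.Theses.TropicalKugaSatakeCayley
import Summits.HodgeConjecture.HodgeConjecture.Theorems.TropicalKugaSatakeCayleyFormalCycleCriterionIsCycleOfIncidences
import Summits.HodgeConjecture.HodgeConjecture.Theorems.TropicalKugaSatakeCayleyFormalCycleCriterionCycleClassRational
import Summits.HodgeConjecture.HodgeConjecture.Theorems.TropicalKugaSatakeCayleyFormalCycleCriterionFormalFamily
import HarnessLib

/-!
# Crux `FormalCycleCriterion` (stmt-HodgeConjecture-18571) of route `TropicalKugaSatakeCayley` — PROVED

Kontsevich's "formal cycles" (Zharkov, *Tropical abelian varieties, Weil classes and the Hodge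
conjecture*, p. 3) for the rank-`7` Kuga–Satake linear family `B_t = Σ t_i · ksForm i` of tropical
tori `ℝ⁸ / B_t ℤ⁸`: if `t ∈ ksPosCone` has `ℚ`-linearly independent coordinates and `Z` is an
effective framed simplicial tropical `2`-cycle of `ℝ⁸ / B_t ℤ⁸`, then on a non-empty open
`U ⊆ ksPosCone` every `B_{t'}`, `t' ∈ U`, carries an effective tropical `2`-cycle with the SAME
period class `compound 2 B_{t'}⁻¹ · classOf`.

This file is the composition of the three registered stubs of the line `birth`
(`Cruxes/FormalCycleCriterion/Lines/birth.lean`), all of which are now theorems of the tree: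

1. `FormalCycleCriterion.stub_formalFamily` (`…FormalFamily`): the formal family of framed chains
   through `Z` over an open preconnected `U ∋ t` in the cone, with the incidences of `Z` persisting,
   effective members and a continuous period class;
2. `FormalCycleCriterion.stub_isCycle_of_incidences` (`…IsCycleOfIncidences`): incidence
   coarsening keeps the cycle condition, so every member is a cycle of its own torus;
3. `FormalCycleCriterion.stub_cycleClassRational` (`…CycleClassRational`): period classes of
   tropical cycles are rational;

and the glue "a continuous rational-valued function on a preconnected set is constant"
(`apply_eq_of_ratValued`, intermediate value theorem + an irrational number between two reals),
exactly as in the skeleton's sorry-free `FormalCycleCriterion_of`. The theorem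
`formalCycleCriterion_proof` has as its type the route declaration
`Summit.HodgeConjecture.HodgeConjecture.Theses.TropicalKugaSatakeCayley.FormalCycleCriterion`.

## References

* [Zharkov2020TropicalWeil] I. Zharkov, Tropical abelian varieties, Weil classes and the Hodge
  conjecture, arXiv:2002.02347 (2020), pp. 2–3.
* [MikhalkinZharkov2014Eigenwave] G. Mikhalkin, I. Zharkov, Tropical eigenwave and intermediate
  Jacobians, LN UMI 15 (2014), Def. 4.2, Prop. 4.3, Thm. 5.4.
-/

noncomputable section

-- `Summit.HodgeConjecture.HodgeConjecture.…` is the mandated namespace (single-conjunct summit).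
set_option linter.dupNamespace false

namespace Summit.HodgeConjecture.HodgeConjecture.Theorems

open Summit.HodgeConjecture.HodgeConjecture.Theses.TropicalKugaSatakeCayley
open Literature.AlgebraicGeometry.Tropical

/-- **Glue.** A continuous rational-valued function on a preconnected set is constant: two
distinct values would enclose an irrational number, attained on the set by the intermediate value
theorem. [folklore] -/
theorem FormalCycleCriterion.apply_eq_of_ratValued {X : Type*} [TopologicalSpace X] {U : Set X}
    (hU : IsPreconnected U) {g : X → ℝ} (hg : ContinuousOn g U) (hq : ∀ s ∈ U, ∃ q : ℚ, g s = q)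
    {a b : X} (ha : a ∈ U) (hb : b ∈ U) : g a = g b := by
  by_contra hne
  rcases lt_or_gt_of_ne hne with h | h
  · obtain ⟨r, hr, har, hrb⟩ := exists_irrational_btwn h
    obtain ⟨s, hs, hsr⟩ := hU.intermediate_value ha hb hg ⟨har.le, hrb.le⟩
    obtain ⟨q, hsq⟩ := hq s hs
    exact hr.ne_rat q (hsr.symm.trans hsq)
  · obtain ⟨r, hr, hbr, hra⟩ := exists_irrational_btwn h
    obtain ⟨s, hs, hsr⟩ := hU.intermediate_value hb ha hg ⟨hbr.le, hra.le⟩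
    obtain ⟨q, hsq⟩ := hq s hs
    exact hr.ne_rat q (hsr.symm.trans hsq)

/-- **The crux `FormalCycleCriterion` (route `TropicalKugaSatakeCayley`, item
stmt-HodgeConjecture-18571).** Given a `ℚ`-generic `t ∈ ksPosCone` and an effective tropical
`2`-cycle `Z` of `ℝ⁸ / B_t ℤ⁸`: stub 1 gives an open preconnected `U ∋ t` in the cone and the formal
family `⟨Z.size, cell t'⟩` through `Z`; stub 2 makes each member a cycle of `ℝ⁸ / B_{t'} ℤ⁸`;
stub 3 makes its period class rational-valued; continuous and rational-valued on the preconnected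
`U`, the period class is constant, equal to that of `Z = ⟨Z.size, cell t⟩`.
[cite: Zharkov2020TropicalWeil, p. 3] [cite: MikhalkinZharkov2014Eigenwave, Prop. 4.3] -/
theorem formalCycleCriterion_proof : FormalCycleCriterion := by
  intro t ht hli Z hZc hZe
  obtain ⟨U, hUo, hUc, htU, hUsub, cell, hcellt, hdw, hinc, heff, hcont⟩ :=
    FormalCycleCriterion.stub_formalFamily t ht hli Z hZc hZe
  -- every member of the family is a tropical cycle of its own torus (stub 2)
  have hcyc : ∀ t' ∈ U, (⟨Z.size, cell t'⟩ : TropicalTorus.Chain ℝ 8 2).IsCycle (ksMatrix t') := by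
    intro t' ht'
    refine FormalCycleCriterion.stub_isCycle_of_incidences Z.size Z.cell (cell t') (ksMatrix t)
      (ksMatrix t') ?_ (hinc t' ht') hZc
    intro c
    funext K
    simp only [TropicalTorus.Cell.framing, (hdw t' c).1, (hdw t' c).2]
  refine ⟨U, hUo, ⟨t, htU⟩, hUsub, fun t' ht' => ⟨⟨Z.size, cell t'⟩, hcyc t' ht', heff t' ht', ?_⟩⟩
  -- the period class is continuous (stub 1) and rational-valued (stub 3) on the preconnected `U`,
  -- hence constant there
  have key : ∀ i j,
      (TropicalTorus.compound 2 (ksMatrix t')⁻¹ *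
          (⟨Z.size, cell t'⟩ : TropicalTorus.Chain ℝ 8 2).classOf) i j =
        (TropicalTorus.compound 2 (ksMatrix t)⁻¹ *
          (⟨Z.size, cell t⟩ : TropicalTorus.Chain ℝ 8 2).classOf) i j := by
    intro i j
    refine FormalCycleCriterion.apply_eq_of_ratValued
      (g := fun s => (TropicalTorus.compound 2 (ksMatrix s)⁻¹ *
        (⟨Z.size, cell s⟩ : TropicalTorus.Chain ℝ 8 2).classOf) i j) hUc ?_ ?_ ht' htU
    · exact (continuous_apply_apply i j).comp_continuousOn hcont
    · intro s hs
      obtain ⟨M, hM⟩ := FormalCycleCriterion.stub_cycleClassRational (ksMatrix s) (hUsub hs) _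
        (hcyc s hs)
      exact ⟨M i j, by rw [hM]; rfl⟩
  have hZ : (⟨Z.size, cell t⟩ : TropicalTorus.Chain ℝ 8 2) = Z := by rw [hcellt]
  exact (Matrix.ext fun i j => key i j).trans (by rw [hZ])

end Summit.HodgeConjecture.HodgeConjecture.Theorems

end
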